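import Summits.CriticalPhenomena.PercolationContinuityZ3.Theorems.PercNearOneGluingNoHeavyLowerTailKnQuestion8CoefficientwiseCoreClassKernelMixTwoStageCharging

/-!
# Two-stage charging with row-dependent witness regions (the counting step of the chordless FULL-induction)

Support file (`--supports stmt-CriticalPhenomena-4575`, closed), prover `prim-cplus-coupling` (gen 73).  No definitions, no notations,
no named facts, no sorries; standard axioms.  Memo `prim-cplus-coupling/A5-COUPLING-gen73.md` §3 (THEOREM RF, the rider-free FULL step).

Context.  `TwoStageCharging.two_stage_charging` sums the row bounds of a two-stage product `Z = X × Y` against the single witness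
space `NFX ×ˢ NFY` (the CHORDED cycle step, THEOREM A).  In the CHORDLESS step the witness currency of a row depends on the row: a
row whose layer is a mixed word is charged against the demand region `G_X` of the smaller bouquet, the row of the full word (layer `⊥`)
against all of `NF_X`, and the total witness space is `G_Z = G_X × NF_Y ∪ NF_X × {⊥}` — not a product.  This file proves the
corresponding abstract counting step `two_stage_charging_regions`: rows `y ∈ NEY` with layers `λ y` (injective), regions `R y ⊆ X` with
`R y × {λ y} ⊆ G`, every collision of row `y` having both `Y`-sources below `λ y`, and the H-bound of row `y` against `R y`, give the
H-bound on `Z` against `G`.  (`TwoStageCharging.two_stage_charging` is the case `R ≡ NFX`, `G = NFX ×ˢ NFY`.)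
[cite: KozmaNitzan2024, Questions 8–9 (§5.5 p. 36) (context); Harris 1960; Kleitman 1966]
-/

namespace Summit.CriticalPhenomena.PercolationContinuityZ3.Theorems.Coefficientwise.TwoStageChargingRegions

open Finset ReducedKleitman TwoStageCharging

variable {X Y : Type*} [Fintype X] [DecidableEq X] [Preorder X] [Fintype Y] [DecidableEq Y] [Preorder Y]

open Classical in
/-- **Two-stage charging with row-dependent regions.**  Let `Coll` be a finite set of pairs of points of `X × Y` ("collisions"), each
assigned a row `row c ∈ NEY`; let `λ : Y → Y` be injective on `NEY`, and let `R y ⊆ X` be the witness region of row `y`, placed at layer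
`λ y` inside the witness space `G` (`(x, λ y) ∈ G` for `x ∈ R y`).  If both `Y`-components of every collision lie below the layer of its
row and in every row the `X`-components satisfy the H-bound against `R y` — the number of collisions of the row whose common upper
`X`-cone lies inside an upper set `U` is at most `#(U ∩ R y)` — then for every upper set `W` of `X × Y` the number of collisions whose
common upper cone lies inside `W` is at most `#(W ∩ G)`. -/
theorem two_stage_charging_regions (NEY : Finset Y) (G : Finset (X × Y))
    (Coll : Finset ((X × Y) × (X × Y))) (row : (X × Y) × (X × Y) → Y) (lam : Y → Y) (R : Y → Finset X)
    (hrow : ∀ c ∈ Coll, row c ∈ NEY)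
    (hlam : Set.InjOn lam (NEY : Set Y)) (hR : ∀ y ∈ NEY, ∀ x ∈ R y, (x, lam y) ∈ G)
    (hyj : ∀ c ∈ Coll, c.1.2 ≤ lam (row c) ∧ c.2.2 ≤ lam (row c))
    (hX : ∀ y ∈ NEY, ∀ U : Finset X, IsUpperSet (U : Set X) →
      ((Coll.filter (fun c => row c = y)).filter
          (fun c => ∀ p : X, c.1.1 ≤ p → c.2.1 ≤ p → p ∈ U)).card ≤ (U ∩ R y).card)
    (W : Finset (X × Y)) (hW : IsUpperSet (W : Set (X × Y))) :
    (Coll.filter (fun c => ∀ q : X × Y, c.1 ≤ q → c.2 ≤ q → q ∈ W)).card ≤ (W ∩ G).card := by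
  set good : (X × Y) × (X × Y) → Prop := fun c => ∀ q : X × Y, c.1 ≤ q → c.2 ≤ q → q ∈ W with hgood
  set S := Coll.filter good with hS
  -- (1) split the good collisions by row
  have hmaps : ∀ c ∈ S, row c ∈ NEY := fun c hc => hrow c (mem_filter.mp hc).1
  have hsplit : S.card = ∑ y ∈ NEY, (S.filter (fun c => row c = y)).card :=
    card_eq_sum_card_fiberwise hmaps
  -- (2) each row is bounded by the X-hypothesis at the layer λ y, against its own region
  have hrowbd : ∀ y ∈ NEY, (S.filter (fun c => row c = y)).card ≤ (fibR W (lam y) ∩ R y).card := by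
    intro y hy
    refine le_trans (card_le_card ?_) (hX y hy (fibR W (lam y)) (isUpperSet_fibR hW (lam y)))
    intro c hc
    rw [mem_filter] at hc
    obtain ⟨hcS, hcy⟩ := hc
    obtain ⟨hcC, hcg⟩ := mem_filter.mp hcS
    refine mem_filter.mpr ⟨mem_filter.mpr ⟨hcC, hcy⟩, ?_⟩
    intro p h1 h2
    rw [mem_fibR]
    have hy1 := (hyj c hcC).1
    have hy2 := (hyj c hcC).2
    rw [hcy] at hy1 hy2
    exact hcg (p, lam y) (Prod.mk_le_mk.mpr ⟨h1, hy1⟩) (Prod.mk_le_mk.mpr ⟨h2, hy2⟩)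
  -- (3) the layered regions embed disjointly into W ∩ G
  set T : Finset (Σ _ : Y, X) := NEY.sigma (fun y => fibR W (lam y) ∩ R y) with hT
  have hTcard : T.card = ∑ y ∈ NEY, (fibR W (lam y) ∩ R y).card := card_sigma _ _
  have hinj : T.card ≤ (W ∩ G).card := by
    refine card_le_card_of_injOn (fun s => (s.2, lam s.1)) ?_ ?_
    · intro s hs
      rw [mem_coe, hT, mem_sigma] at hs
      obtain ⟨hy, hx⟩ := hs
      obtain ⟨hxW, hxR⟩ := mem_inter.mp hx
      rw [mem_fibR] at hxW
      exact mem_coe.mpr (mem_inter.mpr ⟨hxW, hR s.1 hy s.2 hxR⟩)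
    · intro s hs s' hs' h
      rw [mem_coe, hT, mem_sigma] at hs hs'
      simp only [Prod.mk.injEq] at h
      obtain ⟨h2, h1⟩ := h
      have e1 : s.1 = s'.1 := hlam (mem_coe.mpr hs.1) (mem_coe.mpr hs'.1) h1
      exact Sigma.ext e1 (heq_of_eq h2)
  calc S.card = ∑ y ∈ NEY, (S.filter (fun c => row c = y)).card := hsplit
    _ ≤ ∑ y ∈ NEY, (fibR W (lam y) ∩ R y).card := sum_le_sum hrowbd
    _ = T.card := hTcard.symm
    _ ≤ (W ∩ G).card := hinj

end Summit.CriticalPhenomena.PercolationContinuityZ3.Theorems.Coefficientwise.TwoStageChargingRegions
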